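import Summits.RiemannHypothesis.RiemannHypothesis.Theorems.SemilocalDeletionCliff
import Summits.RiemannHypothesis.RiemannHypothesis.Theorems.HandoffSemilocalEnergy
import Literature.NumberTheory.LFunctions.WeilMellinBounds
import HarnessLib

/-!
# The prime-deletion cliff is a SANDWICH: the floor `−Λ(p)/√p` is attained exactly on antisymmetric dipoles

Numerics of the `rh-explicit` cell (lineage E, seat cc-s2-1 gen8–10; HOME/cc-s2-1/gen9/struct/WALSH-E.md §4, 276 certified
single-deletion cells): deleting the prime `p` from the set `S` of primes visible on the window `C(c)`, `c = (log p)/2 + δ`,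
drops the bottom of the semi-local form to `−log p/√p + Δ` with `0 ≤ Δ` tiny and governed by the HALF-ROOM `δ` with the
parity SWAPPED (free-odd `Δ` tracks the even `ζ`-window energy at `δ`, and vice versa; blind-confirmed at two new bandwidths,
the dipole mechanism identified blind by seat handoff-idea-1 g11).  `SemilocalDeletionCliff.lean` proved the FLOOR
`Re Q_{S∖{p}}(g) ≥ Re Q_S(g) − (log p/√p)‖g‖₂²`.  This file proves that the floor is an EQUALITY on the antisymmetric dipoles

  `d_h(t) = h(t + (log p)/2) − h(t − (log p)/2)`,  `h` a test function on the half-room window `[−δ, δ]`, `2δ < log p`: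

* §1 dipole bookkeeping (no primes; separation `L > 2δ`): `d_h` is a test function on `[−(L/2 + δ), L/2 + δ]`,
  `‖d_h‖₂² = 2‖h‖₂²`, its autocorrelation at the separation is `k(L) + k(−L) = −‖d_h‖₂²` (the two blocks sit on DISJOINT
  slivers, so Bombieri's sliver bound `|k(L) + k(−L)| ≤ ‖d_h‖₂²` is attained with the negative sign), and the PARITY SWAP:
  `h` even ⇒ `d_h` odd, `h` odd ⇒ `d_h` even;
* §2 **`weilSemilocalQuadratic_erase_dipole`**: `Q_{S∖{p}}(d_h) = Q_S(d_h) − (log p/√p)·‖d_h‖₂²` EXACTLY (every finite `S ∋ p`);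
* §3 in the tree's energy language (`semilocalGroundEnergy S P c = λ_min(S; c; P)`): the FLOOR
  `λ_min(S∖{p}; c; P) ≥ λ_min(S; c; P) − log p/√p` for every constraint `P` and every `c < log p`, and the CEILING
  `(λ_min(S∖{p}; (log p)/2 + δ; P) + log p/√p)·2‖h‖₂² ≤ Re Q_S(d_h)` for every block `h ∈ C(δ)` whose dipole satisfies `P`
  — in particular for the free sectors with the parity SWAPPED (`h` even for `P` = odd, `h` odd for `P` = even).
  So `0 ≤ Δ ≤ D`, `D` = the dipole energy of the UNDELETED form on blocks of half-width `δ` (= the cell's wall-offset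
  coordinate `b − (log p)/2`): the cliff law's SHAPE — limit `−log p/√p`, sign of the offset, the half-room as the variable,
  the sector swap — is a theorem for every finite `S`; only the SIZE of the offset is data (lineage E: `Δ ≤ 6e-12` at room
  `2δ ≥ 1.45`, rising to `0.4–0.7` as `δ → 0`; idea-1's blind dipole/three-block values reproduce it to a few per cent).

§4 (appended): the SYMMETRIC pair `h₊ + h₋` is RAISED by exactly `w‖·‖₂²` under deletion — the two-block picture in full.
Nothing here bears on RH; these are statements about truncated Weil forms.
-/

set_option linter.dupNamespace false

noncomputable section

open Complex Filter Set MeasureTheory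
open scoped Real Topology ComplexConjugate

namespace Summit.RiemannHypothesis.RiemannHypothesis.Theorems.SemilocalDeletionDipole

open Literature.NumberTheory.LFunctions
open Summit.RiemannHypothesis.RiemannHypothesis.Theorems.SemilocalDeletionCliff
open Summit.RiemannHypothesis.RiemannHypothesis.Theorems.HandoffSemilocalEnergy

variable {h : ℝ → ℂ} {δ L : ℝ}

/-! ## §1  The antisymmetric dipole of a block `h ∈ C(δ)` at separation `L > 2δ` -/

/-- Blocks on far-apart windows do not interact pointwise: if `tsupport h ⊆ [−δ, δ]` and `|a − b| > 2δ` then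
`h(a)·conj h(b) = 0`. -/
theorem mul_conj_eq_zero_of_far (hsupp : tsupport h ⊆ Icc (-δ) δ) {a b : ℝ} (hab : 2 * δ < |a - b|) :
    h a * conj (h b) = 0 := by
  by_cases ha : h a = 0
  · rw [ha, zero_mul]
  by_cases hb : h b = 0
  · rw [hb, map_zero, mul_zero]
  have h1 := hsupp (subset_tsupport _ (Function.mem_support.2 ha))
  have h2 := hsupp (subset_tsupport _ (Function.mem_support.2 hb))
  rw [mem_Icc] at h1 h2
  have : |a - b| ≤ 2 * δ := abs_le.2 ⟨by linarith, by linarith⟩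
  linarith

/-- `(φ ⋆ φ̃)(t) = ∫ φ(u) conj φ(u − t) du`. -/
theorem weilConv_weilReflect_apply' (φ : ℝ → ℂ) (t : ℝ) :
    weilConv φ (weilReflect φ) t = ∫ u : ℝ, φ u * conj (φ (u - t)) := by
  rw [weilConv_apply]
  congr 1 with u
  simp [weilReflect, neg_sub]

/-- The dipole is a Weil test function. -/
theorem isWeilTest_dipole (hh : IsWeilTest h) (L : ℝ) :
    IsWeilTest (fun t ↦ h (t + L / 2) - h (t - L / 2)) := by
  have := (hh.weilTranslate (-(L / 2))).add ((hh.weilTranslate (L / 2)).const_mul (-1))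
  convert this using 1
  funext t
  simp only [Pi.add_apply, weilTranslate, sub_neg_eq_add]
  ring

/-- Support of the dipole: `tsupport d_h ⊆ [−(L/2 + δ), L/2 + δ]` for `h ∈ C(δ)`, `L ≥ 0`. -/
theorem tsupport_dipole_subset (hsupp : tsupport h ⊆ Icc (-δ) δ) (hL : 0 ≤ L) :
    tsupport (fun t ↦ h (t + L / 2) - h (t - L / 2)) ⊆ Icc (-(L / 2 + δ)) (L / 2 + δ) := by
  refine (isClosed_Icc.closure_subset_iff).2 fun t ht ↦ ?_
  rw [Function.mem_support] at ht
  by_cases h1 : h (t + L / 2) = 0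
  · have h2 : h (t - L / 2) ≠ 0 := fun h2 ↦ ht (by rw [h1, h2, sub_zero])
    have := hsupp (subset_tsupport _ (Function.mem_support.2 h2))
    rw [mem_Icc] at this ⊢
    constructor <;> linarith [this.1, this.2]
  · have := hsupp (subset_tsupport _ (Function.mem_support.2 h1))
    rw [mem_Icc] at this ⊢
    constructor <;> linarith [this.1, this.2]

/-- PARITY SWAP (i): the dipole of an EVEN block is ODD. -/
theorem dipole_odd_of_even (heven : ∀ t, h (-t) = h t) (L t : ℝ) :
    h (-t + L / 2) - h (-t - L / 2) = -(h (t + L / 2) - h (t - L / 2)) := by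
  rw [show -t + L / 2 = -(t - L / 2) by ring, show -t - L / 2 = -(t + L / 2) by ring, heven, heven]
  ring

/-- PARITY SWAP (ii): the dipole of an ODD block is EVEN. -/
theorem dipole_even_of_odd (hodd : ∀ t, h (-t) = -h t) (L t : ℝ) :
    h (-t + L / 2) - h (-t - L / 2) = h (t + L / 2) - h (t - L / 2) := by
  rw [show -t + L / 2 = -(t - L / 2) by ring, show -t - L / 2 = -(t + L / 2) by ring, hodd, hodd]
  ring

/-- Pointwise Pythagoras: for `2δ < L` the two blocks of the dipole never overlap,
`‖d_h(u)‖² = ‖h(u + L/2)‖² + ‖h(u − L/2)‖²`. -/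
theorem norm_sq_dipole_apply (hsupp : tsupport h ⊆ Icc (-δ) δ) (hL : 2 * δ < L) (u : ℝ) :
    ‖h (u + L / 2) - h (u - L / 2)‖ ^ 2 = ‖h (u + L / 2)‖ ^ 2 + ‖h (u - L / 2)‖ ^ 2 := by
  by_cases h1 : h (u + L / 2) = 0
  · simp [h1]
  · have hfar : 2 * δ < |(u + L / 2) - (u - L / 2)| := by
      rw [show (u + L / 2) - (u - L / 2) = L by ring]
      exact hL.trans_le (le_abs_self L)
    have hcross := mul_conj_eq_zero_of_far hsupp hfar
    have h2 : h (u - L / 2) = 0 := by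
      rcases mul_eq_zero.1 hcross with h0 | h0
      · exact absurd h0 h1
      · simpa using h0
    simp [h2]

/-- **`‖d_h‖₂² = 2‖h‖₂²`** for `h ∈ C(δ)`, `2δ < L`. -/
theorem integral_norm_sq_dipole (hh : IsWeilTest h) (hsupp : tsupport h ⊆ Icc (-δ) δ) (hL : 2 * δ < L) :
    ∫ u : ℝ, ‖h (u + L / 2) - h (u - L / 2)‖ ^ 2 = 2 * ∫ u : ℝ, ‖h u‖ ^ 2 := by
  simp_rw [norm_sq_dipole_apply hsupp hL]
  have hi := hh.integrable_norm_sq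
  rw [integral_add (hi.comp_add_right (L / 2)) (hi.comp_sub_right (L / 2)),
    integral_add_right_eq_self (fun u : ℝ ↦ ‖h u‖ ^ 2) (L / 2),
    integral_sub_right_eq_self (fun u : ℝ ↦ ‖h u‖ ^ 2) (L / 2)]
  ring

/-- The autocorrelation of the dipole at the separation: `k_{d_h}(L) = −‖h‖₂²` (the only surviving product is
`−h(u − L/2)·conj h(u − L/2)`; the three others pair blocks `≥ L > 2δ` apart). -/
theorem weilConv_weilReflect_dipole_apply_sep (hsupp : tsupport h ⊆ Icc (-δ) δ) (hL : 2 * δ < L) :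
    weilConv (fun t ↦ h (t + L / 2) - h (t - L / 2)) (weilReflect fun t ↦ h (t + L / 2) - h (t - L / 2)) L =
      -(((∫ u : ℝ, ‖h u‖ ^ 2 : ℝ)) : ℂ) := by
  have hfar1 : 2 * δ < |L| := hL.trans_le (le_abs_self L)
  have hfar2 : 2 * δ < |2 * L| := by
    rcases le_or_gt 0 L with h0 | h0
    · rw [abs_of_nonneg (by linarith)]; linarith
    · linarith [abs_nonneg (2 * L)]
  rw [weilConv_weilReflect_apply']
  show ∫ u : ℝ, (h (u + L / 2) - h (u - L / 2)) * conj (h (u - L + L / 2) - h (u - L - L / 2)) = _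
  have hpt : ∀ u : ℝ, (h (u + L / 2) - h (u - L / 2)) * conj (h (u - L + L / 2) - h (u - L - L / 2)) =
      -((‖h (u - L / 2)‖ ^ 2 : ℝ) : ℂ) := by
    intro u
    have z1 : h (u + L / 2) * conj (h (u - L + L / 2)) = 0 :=
      mul_conj_eq_zero_of_far hsupp (by rw [show u + L / 2 - (u - L + L / 2) = L by ring]; exact hfar1)
    have z2 : h (u + L / 2) * conj (h (u - L - L / 2)) = 0 :=
      mul_conj_eq_zero_of_far hsupp (by rw [show u + L / 2 - (u - L - L / 2) = 2 * L by ring]; exact hfar2)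
    have z3 : h (u - L / 2) * conj (h (u - L - L / 2)) = 0 :=
      mul_conj_eq_zero_of_far hsupp (by rw [show u - L / 2 - (u - L - L / 2) = L by ring]; exact hfar1)
    have e : u - L + L / 2 = u - L / 2 := by ring
    rw [e] at z1 ⊢
    rw [map_sub, ← Complex.normSq_eq_norm_sq, ← Complex.mul_conj]
    linear_combination z1 - z2 + z3
  simp_rw [hpt]
  rw [integral_neg, integral_complex_ofReal, integral_sub_right_eq_self (fun u : ℝ ↦ ‖h u‖ ^ 2) (L / 2)]

/-- **The sliver bound is attained**: `k_{d_h}(L) + k_{d_h}(−L) = −‖d_h‖₂²` (`= −2‖h‖₂²`). -/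
theorem weilConv_weilReflect_dipole_add_neg (hh : IsWeilTest h) (hsupp : tsupport h ⊆ Icc (-δ) δ) (hL : 2 * δ < L) :
    weilConv (fun t ↦ h (t + L / 2) - h (t - L / 2)) (weilReflect fun t ↦ h (t + L / 2) - h (t - L / 2)) L +
        weilConv (fun t ↦ h (t + L / 2) - h (t - L / 2)) (weilReflect fun t ↦ h (t + L / 2) - h (t - L / 2)) (-L) =
      -(((∫ u : ℝ, ‖h (u + L / 2) - h (u - L / 2)‖ ^ 2 : ℝ)) : ℂ) := by
  have h1 := weilConv_weilReflect_dipole_apply_sep hsupp hL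
  have h2 : weilConv (fun t ↦ h (t + L / 2) - h (t - L / 2)) (weilReflect fun t ↦ h (t + L / 2) - h (t - L / 2)) (-L) =
      -(((∫ u : ℝ, ‖h u‖ ^ 2 : ℝ)) : ℂ) := by
    have := congrArg conj (conj_weilConv_weilReflect_neg (fun t ↦ h (t + L / 2) - h (t - L / 2)) L)
    rw [Complex.conj_conj] at this
    rw [this, h1, map_neg, Complex.conj_ofReal]
  rw [h1, h2, integral_norm_sq_dipole hh hsupp hL]
  push_cast
  ring

/-! ## §2  Deleting `p`: the floor is an equality on dipoles at separation `log p` -/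

variable {S : Finset ℕ} {p : ℕ}

/-- `0 < log p` for a prime `p`. -/
theorem log_prime_pos (hp : p.Prime) : 0 < Real.log p :=
  Real.log_pos (by exact_mod_cast hp.one_lt)

/-- **The deletion cliff is attained on dipoles.** For `p ∈ S` prime, a block `h ∈ C(δ)` with `2δ < log p`, and the
antisymmetric dipole `d_h(t) = h(t + (log p)/2) − h(t − (log p)/2)`:
`Q_{S∖{p}}(d_h) = Q_S(d_h) − (log p/√p)·‖d_h‖₂²` — equality in the floor `re_weilSemilocalQuadratic_erase_ge`. -/
theorem weilSemilocalQuadratic_erase_dipole (hh : IsWeilTest h) (hsupp : tsupport h ⊆ Icc (-δ) δ) (hp : p.Prime)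
    (hpS : p ∈ S) (hδ : 2 * δ < Real.log p) :
    weilSemilocalQuadratic (S.erase p) (fun t ↦ h (t + Real.log p / 2) - h (t - Real.log p / 2)) =
      weilSemilocalQuadratic S (fun t ↦ h (t + Real.log p / 2) - h (t - Real.log p / 2)) -
        ((Real.log p / Real.sqrt p : ℝ) : ℂ) *
          (((∫ u : ℝ, ‖h (u + Real.log p / 2) - h (u - Real.log p / 2)‖ ^ 2 : ℝ)) : ℂ) := by
  have hL := log_prime_pos hp
  have hd := isWeilTest_dipole hh (Real.log p)
  have hds := tsupport_dipole_subset hsupp hL.le (L := Real.log p)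
  have hc : Real.log p / 2 + δ < Real.log p := by linarith
  have hid := weilSemilocalQuadratic_sub_erase hd hp hpS hds hc
  rw [weilConv_weilReflect_dipole_add_neg hh hsupp hδ] at hid
  linear_combination (-1 : ℂ) * hid

/-- Real-part form: `Re Q_{S∖{p}}(d_h) = Re Q_S(d_h) − (log p/√p)·2‖h‖₂²`. -/
theorem re_weilSemilocalQuadratic_erase_dipole (hh : IsWeilTest h) (hsupp : tsupport h ⊆ Icc (-δ) δ) (hp : p.Prime)
    (hpS : p ∈ S) (hδ : 2 * δ < Real.log p) :
    (weilSemilocalQuadratic (S.erase p) (fun t ↦ h (t + Real.log p / 2) - h (t - Real.log p / 2))).re =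
      (weilSemilocalQuadratic S (fun t ↦ h (t + Real.log p / 2) - h (t - Real.log p / 2))).re -
        Real.log p / Real.sqrt p * (2 * ∫ u : ℝ, ‖h u‖ ^ 2) := by
  rw [weilSemilocalQuadratic_erase_dipole hh hsupp hp hpS hδ, ← integral_norm_sq_dipole hh hsupp hδ, Complex.sub_re,
    ← Complex.ofReal_mul, Complex.ofReal_re]

/-! ## §3  The sandwich in energy language -/

variable {P : (ℝ → ℂ) → Prop} {c : ℝ}

/-- **FLOOR (aggregate).** For every constraint `P`, every finite `S ∋ p` (`p` prime) and every window `c < log p`: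
`λ_min(S∖{p}; c; P) ≥ λ_min(S; c; P) − log p/√p`. -/
theorem semilocalGroundEnergy_erase_ge (hp : p.Prime) (hpS : p ∈ S) (hc : c < Real.log p) :
    semilocalGroundEnergy S P c - Real.log p / Real.sqrt p ≤ semilocalGroundEnergy (S.erase p) P c := by
  rcases (semilocalSphereValues (S.erase p) P c).eq_empty_or_nonempty with he | hne
  · -- empty sphere: both energies are the junk value 0
    have he' : semilocalSphereValues S P c = ∅ := by
      rcases (semilocalSphereValues S P c).eq_empty_or_nonempty with h0 | h0
      · exact h0
      · have := (semilocalSphereValues_nonempty_iff S P c).1 h0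
        rw [← semilocalSphereValues_nonempty_iff (S.erase p) P c, he] at this
        exact absurd this Set.not_nonempty_empty
    rw [semilocalGroundEnergy, semilocalGroundEnergy, he, he', Real.sInf_empty]
    have : 0 ≤ Real.log p / Real.sqrt p := div_nonneg (log_prime_pos hp).le (Real.sqrt_nonneg _)
    linarith
  · refine le_semilocalGroundEnergy hne fun g hg hs hPg hn ↦ ?_
    have h1 := re_weilSemilocalQuadratic_erase_ge hg hp hpS hs hc
    have h2 := semilocalGroundEnergy_le_re (S := S) hg hs hPg hn
    rw [hn, mul_one] at h1
    linarith

/-- **CEILING (dipole test).** For `p ∈ S` prime, a half-room `δ` with `2δ < log p`, and a block `h ∈ C(δ)` whose dipole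
(and its positive multiples) satisfies the constraint `P`:
`(λ_min(S∖{p}; (log p)/2 + δ; P) + log p/√p)·2‖h‖₂² ≤ Re Q_S(d_h)` — the offset above the floor is at most the dipole energy
of the UNDELETED form. -/
theorem semilocalGroundEnergy_erase_add_mul_le (hh : IsWeilTest h) (hsupp : tsupport h ⊆ Icc (-δ) δ) (hp : p.Prime)
    (hpS : p ∈ S) (hδ : 2 * δ < Real.log p)
    (hP : ∀ a : ℝ, 0 < a → P fun t ↦ (a : ℂ) * (h (t + Real.log p / 2) - h (t - Real.log p / 2))) :
    (semilocalGroundEnergy (S.erase p) P (Real.log p / 2 + δ) + Real.log p / Real.sqrt p) * (2 * ∫ u : ℝ, ‖h u‖ ^ 2) ≤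
      (weilSemilocalQuadratic S (fun t ↦ h (t + Real.log p / 2) - h (t - Real.log p / 2))).re := by
  have hL := log_prime_pos hp
  have hd := isWeilTest_dipole hh (Real.log p)
  have hds := tsupport_dipole_subset hsupp hL.le (L := Real.log p)
  have hR := semilocalGroundEnergy_mul_le_re (S := S.erase p) (P := P) hd hds hP
  rw [integral_norm_sq_dipole hh hsupp hδ, re_weilSemilocalQuadratic_erase_dipole hh hsupp hp hpS hδ] at hR
  rw [add_mul]
  linarith

/-- CEILING, all sectors: `(λ_min(S∖{p}; (log p)/2 + δ) + log p/√p)·2‖h‖₂² ≤ Re Q_S(d_h)` for every block `h ∈ C(δ)`. -/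
theorem semilocalGroundEnergy_erase_top_add_mul_le (hh : IsWeilTest h) (hsupp : tsupport h ⊆ Icc (-δ) δ) (hp : p.Prime)
    (hpS : p ∈ S) (hδ : 2 * δ < Real.log p) :
    (semilocalGroundEnergy (S.erase p) (fun _ ↦ True) (Real.log p / 2 + δ) + Real.log p / Real.sqrt p) *
        (2 * ∫ u : ℝ, ‖h u‖ ^ 2) ≤
      (weilSemilocalQuadratic S (fun t ↦ h (t + Real.log p / 2) - h (t - Real.log p / 2))).re :=
  semilocalGroundEnergy_erase_add_mul_le hh hsupp hp hpS hδ fun _ _ ↦ trivial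

/-- **CEILING with the PARITY SWAP (odd sector ← even blocks).** For an EVEN block `h ∈ C(δ)`:
`(λ_min(S∖{p}; (log p)/2 + δ; odd) + log p/√p)·2‖h‖₂² ≤ Re Q_S(d_h)`. -/
theorem semilocalGroundEnergy_erase_odd_add_mul_le (hh : IsWeilTest h) (hsupp : tsupport h ⊆ Icc (-δ) δ)
    (heven : ∀ t, h (-t) = h t) (hp : p.Prime) (hpS : p ∈ S) (hδ : 2 * δ < Real.log p) :
    (semilocalGroundEnergy (S.erase p) (fun g ↦ ∀ t, g (-t) = -g t) (Real.log p / 2 + δ) + Real.log p / Real.sqrt p) *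
        (2 * ∫ u : ℝ, ‖h u‖ ^ 2) ≤
      (weilSemilocalQuadratic S (fun t ↦ h (t + Real.log p / 2) - h (t - Real.log p / 2))).re := by
  refine semilocalGroundEnergy_erase_add_mul_le hh hsupp hp hpS hδ fun a _ t ↦ ?_
  show (a : ℂ) * (h (-t + Real.log p / 2) - h (-t - Real.log p / 2)) =
    -((a : ℂ) * (h (t + Real.log p / 2) - h (t - Real.log p / 2)))
  rw [dipole_odd_of_even heven]
  ring

/-- **CEILING with the PARITY SWAP (even sector ← odd blocks).** For an ODD block `h ∈ C(δ)`:
`(λ_min(S∖{p}; (log p)/2 + δ; even) + log p/√p)·2‖h‖₂² ≤ Re Q_S(d_h)`. -/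
theorem semilocalGroundEnergy_erase_even_add_mul_le (hh : IsWeilTest h) (hsupp : tsupport h ⊆ Icc (-δ) δ)
    (hodd : ∀ t, h (-t) = -h t) (hp : p.Prime) (hpS : p ∈ S) (hδ : 2 * δ < Real.log p) :
    (semilocalGroundEnergy (S.erase p) (fun g ↦ ∀ t, g (-t) = g t) (Real.log p / 2 + δ) + Real.log p / Real.sqrt p) *
        (2 * ∫ u : ℝ, ‖h u‖ ^ 2) ≤
      (weilSemilocalQuadratic S (fun t ↦ h (t + Real.log p / 2) - h (t - Real.log p / 2))).re := by
  refine semilocalGroundEnergy_erase_add_mul_le hh hsupp hp hpS hδ fun a _ t ↦ ?_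
  show (a : ℂ) * (h (-t + Real.log p / 2) - h (-t - Real.log p / 2)) =
    (a : ℂ) * (h (t + Real.log p / 2) - h (t - Real.log p / 2))
  rw [dipole_even_of_odd hodd]

/-! ## §4  The symmetric pair: deletion RAISES it by exactly `w‖s_h‖₂²` (why the floor needs the ANTIsymmetric dipole) -/

variable {h : ℝ → ℂ} {δ L : ℝ}

/-- The symmetric pair `s_h(t) = h(t + L/2) + h(t − L/2)` is a Weil test function. -/
theorem isWeilTest_symPair (hh : IsWeilTest h) (L : ℝ) : IsWeilTest (fun t ↦ h (t + L / 2) + h (t - L / 2)) := by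
  have := (hh.weilTranslate (-(L / 2))).add (hh.weilTranslate (L / 2))
  convert this using 1
  funext t
  simp only [Pi.add_apply, weilTranslate, sub_neg_eq_add]

/-- Support of the symmetric pair: inside `[−(L/2 + δ), L/2 + δ]` for `h ∈ C(δ)`, `L ≥ 0`. -/
theorem tsupport_symPair_subset' (hsupp : tsupport h ⊆ Icc (-δ) δ) (hL : 0 ≤ L) :
    tsupport (fun t ↦ h (t + L / 2) + h (t - L / 2)) ⊆ Icc (-(L / 2 + δ)) (L / 2 + δ) := by
  refine (isClosed_Icc.closure_subset_iff).2 fun t ht ↦ ?_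
  rw [Function.mem_support] at ht
  by_cases h1 : h (t + L / 2) = 0
  · have h2 : h (t - L / 2) ≠ 0 := fun h2 ↦ ht (by rw [h1, h2, add_zero])
    have := hsupp (subset_tsupport _ (Function.mem_support.2 h2))
    rw [mem_Icc] at this ⊢
    constructor <;> linarith [this.1, this.2]
  · have := hsupp (subset_tsupport _ (Function.mem_support.2 h1))
    rw [mem_Icc] at this ⊢
    constructor <;> linarith [this.1, this.2]

/-- Pointwise Pythagoras for the symmetric pair (`2δ < L`): `‖s_h(u)‖² = ‖h(u + L/2)‖² + ‖h(u − L/2)‖²`. -/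
theorem norm_sq_symPair_apply (hsupp : tsupport h ⊆ Icc (-δ) δ) (hL : 2 * δ < L) (u : ℝ) :
    ‖h (u + L / 2) + h (u - L / 2)‖ ^ 2 = ‖h (u + L / 2)‖ ^ 2 + ‖h (u - L / 2)‖ ^ 2 := by
  by_cases h1 : h (u + L / 2) = 0
  · simp [h1]
  · have hfar : 2 * δ < |(u + L / 2) - (u - L / 2)| := by
      rw [show (u + L / 2) - (u - L / 2) = L by ring]
      exact hL.trans_le (le_abs_self L)
    have hcross := mul_conj_eq_zero_of_far hsupp hfar
    have h2 : h (u - L / 2) = 0 := by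
      rcases mul_eq_zero.1 hcross with h0 | h0
      · exact absurd h0 h1
      · simpa using h0
    simp [h2]

/-- `‖s_h‖₂² = 2‖h‖₂²` for `h ∈ C(δ)`, `2δ < L`. -/
theorem integral_norm_sq_symPair (hh : IsWeilTest h) (hsupp : tsupport h ⊆ Icc (-δ) δ) (hL : 2 * δ < L) :
    ∫ u : ℝ, ‖h (u + L / 2) + h (u - L / 2)‖ ^ 2 = 2 * ∫ u : ℝ, ‖h u‖ ^ 2 := by
  simp_rw [norm_sq_symPair_apply hsupp hL]
  have hi := hh.integrable_norm_sq
  rw [integral_add (hi.comp_add_right (L / 2)) (hi.comp_sub_right (L / 2)),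
    integral_add_right_eq_self (fun u : ℝ ↦ ‖h u‖ ^ 2) (L / 2),
    integral_sub_right_eq_self (fun u : ℝ ↦ ‖h u‖ ^ 2) (L / 2)]
  ring

/-- The autocorrelation of the symmetric pair at the separation: `k_{s_h}(L) = +‖h‖₂²`. -/
theorem weilConv_weilReflect_symPair_apply_sep (hsupp : tsupport h ⊆ Icc (-δ) δ) (hL : 2 * δ < L) :
    weilConv (fun t ↦ h (t + L / 2) + h (t - L / 2)) (weilReflect fun t ↦ h (t + L / 2) + h (t - L / 2)) L =
      (((∫ u : ℝ, ‖h u‖ ^ 2 : ℝ)) : ℂ) := by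
  have hfar1 : 2 * δ < |L| := hL.trans_le (le_abs_self L)
  have hfar2 : 2 * δ < |2 * L| := by
    rcases le_or_gt 0 L with h0 | h0
    · rw [abs_of_nonneg (by linarith)]; linarith
    · linarith [abs_nonneg (2 * L)]
  rw [weilConv_weilReflect_apply']
  show ∫ u : ℝ, (h (u + L / 2) + h (u - L / 2)) * conj (h (u - L + L / 2) + h (u - L - L / 2)) = _
  have hpt : ∀ u : ℝ, (h (u + L / 2) + h (u - L / 2)) * conj (h (u - L + L / 2) + h (u - L - L / 2)) =
      ((‖h (u - L / 2)‖ ^ 2 : ℝ) : ℂ) := by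
    intro u
    have z1 : h (u + L / 2) * conj (h (u - L + L / 2)) = 0 :=
      mul_conj_eq_zero_of_far hsupp (by rw [show u + L / 2 - (u - L + L / 2) = L by ring]; exact hfar1)
    have z2 : h (u + L / 2) * conj (h (u - L - L / 2)) = 0 :=
      mul_conj_eq_zero_of_far hsupp (by rw [show u + L / 2 - (u - L - L / 2) = 2 * L by ring]; exact hfar2)
    have z3 : h (u - L / 2) * conj (h (u - L - L / 2)) = 0 :=
      mul_conj_eq_zero_of_far hsupp (by rw [show u - L / 2 - (u - L - L / 2) = L by ring]; exact hfar1)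
    have e : u - L + L / 2 = u - L / 2 := by ring
    rw [e] at z1 ⊢
    rw [map_add, ← Complex.normSq_eq_norm_sq, ← Complex.mul_conj]
    linear_combination z1 + z2 + z3
  simp_rw [hpt]
  rw [integral_complex_ofReal, integral_sub_right_eq_self (fun u : ℝ ↦ ‖h u‖ ^ 2) (L / 2)]

/-- **Deleting `p` RAISES the symmetric pair by exactly `w‖s_h‖₂²`.** For `p ∈ S` prime, `h ∈ C(δ)`, `2δ < log p`:
`Q_{S∖{p}}(s_h) = Q_S(s_h) + (log p/√p)·‖s_h‖₂²` — the companion of `weilSemilocalQuadratic_erase_dipole` (there `−`): on the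
two-block space the deleted atom acts as `∓w` on the antisymmetric / symmetric combination, which is why the FLOOR `−w` is attained by
the antisymmetric dipole and the symmetric pair sits at the opposite end. -/
theorem weilSemilocalQuadratic_erase_symPair (hh : IsWeilTest h) (hsupp : tsupport h ⊆ Icc (-δ) δ) {S : Finset ℕ} {p : ℕ}
    (hp : p.Prime) (hpS : p ∈ S) (hδ : 2 * δ < Real.log p) :
    weilSemilocalQuadratic (S.erase p) (fun t ↦ h (t + Real.log p / 2) + h (t - Real.log p / 2)) =
      weilSemilocalQuadratic S (fun t ↦ h (t + Real.log p / 2) + h (t - Real.log p / 2)) +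
        ((Real.log p / Real.sqrt p : ℝ) : ℂ) *
          (((∫ u : ℝ, ‖h (u + Real.log p / 2) + h (u - Real.log p / 2)‖ ^ 2 : ℝ)) : ℂ) := by
  have hL := log_prime_pos hp
  have hs := isWeilTest_symPair hh (Real.log p)
  have hss := tsupport_symPair_subset' hsupp hL.le (L := Real.log p)
  have hc : Real.log p / 2 + δ < Real.log p := by linarith
  have hid := weilSemilocalQuadratic_sub_erase hs hp hpS hss hc
  have h1 := weilConv_weilReflect_symPair_apply_sep hsupp hδ (h := h) (L := Real.log p)
  have h2 : weilConv (fun t ↦ h (t + Real.log p / 2) + h (t - Real.log p / 2))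
      (weilReflect fun t ↦ h (t + Real.log p / 2) + h (t - Real.log p / 2)) (-Real.log p) = (((∫ u : ℝ, ‖h u‖ ^ 2 : ℝ)) : ℂ) := by
    have := congrArg conj (conj_weilConv_weilReflect_neg (fun t ↦ h (t + Real.log p / 2) + h (t - Real.log p / 2)) (Real.log p))
    rw [Complex.conj_conj] at this
    rw [this, h1, Complex.conj_ofReal]
  rw [h1, h2] at hid
  rw [integral_norm_sq_symPair hh hsupp hδ, Complex.ofReal_mul, Complex.ofReal_ofNat]
  linear_combination (-1 : ℂ) * hid

end Summit.RiemannHypothesis.RiemannHypothesis.Theorems.SemilocalDeletionDipole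

end
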